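import Summits.QuantumFields.BalabanUV.T4Continuum.Support.DirichletSplittableCriterion

/-!
# `BalabanUV.T4Continuum.Support.DirichletSplittableResidue` — NE2 (node U1a) formalisation swarm, SUPPLIER item «Δ1-LOCAL» under the
# owner's sub-row `T4-U1a.S-NE2-D1-DIRICHLET°`: THE LOCATED RESIDUE AS THEOREMS — two block sets on the `4 × 4 × 4` block torus that are
# NOT locally splittable: the spiral 4-chain, and the COMPLEMENT OF A CORNER CONTACT (all blocks but two touching at one vertex)
# (unit b2b-balaban-t4-ne2-formalise-leaf-08, gen 5, file 7 — negative instances; nothing analytic)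

HONEST FRAMING.  Rung (B)+1 bookkeeping at MODEL level, finite torus; pure combinatorics; NE2 (U1a) is NOT proved by this file; spine PROVED 0/9
unchanged; NOT infinite volume, NOT the mass gap, NOT Clay.  HONEST DEPENDENCY (verbatim): «continuum YM on T⁴ ⇐ BetaPertH ∧ nine spine
estimates (0/9 proved); BetaPertH ⇐ (D1) ∧ (D4) ∧ CAP+tail; G-an2-4 gates asym, D1 and NE2/3/4.»

WHY THIS FILE.  The hypothesis `LocallySplittable` of the «Δ1-LOCAL» ENDs (`DirichletSplittableTwoLevel`) is EVERYTHING in `d = 2`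
(`DirichletSplittableExamples.locallySplittable₂`) and is characterised in general by «no μ-conflict path in any vertex patch»
(`DirichletSplittableCriterion.locallySplittable_iff_conflictFree`).  For the programme's regions — complements `Ω = (⋃ cubes)ᶜ` of
large-field cube unions — the residue is NOT exotic: wherever two removed cubes meet in a vertex only (d = 3), the patch of `Ω` at that vertex
is «all octants but two antipodal ones», which carries a conflict path.  This file records both facts as kernel theorems on the concrete block
torus `(ZMod 4)³`, so that no reader over-extends the scope of the ENDs:
 * **`not_splittableAt_spiral`**, **`not_locallySplittable_spiral`** — `S = {(0,0,0),(1,0,0),(1,1,0),(1,1,1)}`, vertex `(1,1,1)`, axis `1`;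
 * **`not_splittableAt_antiCorner`**, **`not_locallySplittable_antiCorner`** — `S = all blocks except (0,0,0) and (1,1,1)`, vertex `(1,1,1)`,
   axis `0`: top-exposed lower `(0,1,1)`, bottom-exposed upper `(1,0,0)`, conflict path `(0,1,1) → (0,1,0) → (1,1,0) → (1,0,0)`.
 (An edge-only contact of two removed cubes likewise yields a conflict path — prose in `t4/T4-EST-NE2-D1-LOCAL.md` §2.)

ABSOLUTE RULE (cell, verbatim): «No internally-minted statement may enter as a cited fact. Every hypothesis is either kernel-proved in
this package or a verbatim quotation of a PUBLISHED theorem with page reference. The manuscript(s) under audit are NOT citable for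
their own disputed steps — they are the thing under adjudication; programme-internal (2001/route/tribunal) claims are never citable.»
[folklore]; concrete data defs only; no `def … : Prop` fact.  NOT CLAIMED: that the two-level law FAILS there (numerically it holds at the torus
rate, memo §3) — only that the one-sided splitting method does not reach these sets; NE2; NE3; «not in print».
-/

namespace Summit.QuantumFields.BalabanUV.T4Continuum.DirichletSplittableResidue

open Literature.MathematicalPhysics.QuantumFieldTheory.Balaban1983to89.B5Prop11Plancherel (Tor unitVec)
open Summit.QuantumFields.BalabanUV.T4Continuum.DirichletMonotoneCutoff (InPatch)
open Summit.QuantumFields.BalabanUV.T4Continuum.DirichletSplitPieces (SplittableAt LocallySplittable)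
open Summit.QuantumFields.BalabanUV.T4Continuum.DirichletSplittableCriterion (padj PConn TopExposedLower BotExposedUpper
  conflictFree_of_splittableAt)

/-- the `4 × 4 × 4` block torus. [folklore] -/
abbrev M3 : Fin 3 → ℕ := fun _ => 4

/-- every side of the block torus is non-zero. [folklore] -/
instance (μ : Fin 3) : NeZero (M3 μ) := ⟨by simp [M3]⟩

/-- the block with coordinates `(a₀, a₁, a₂)`. [folklore] -/
def blk (a₀ a₁ a₂ : ZMod 4) : Tor M3 := fun ν => ![a₀, a₁, a₂] ν

/-- the common vertex `(1,1,1)` of the two examples. [folklore] -/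
def v₁ : Tor M3 := blk 1 1 1

/-! ## §1 The spiral 4-chain -/

/-- the spiral 4-chain of cubes around the vertex `(1,1,1)`. [folklore] -/
def spiral (x : Tor M3) : Prop := x = blk 0 0 0 ∨ x = blk 1 0 0 ∨ x = blk 1 1 0 ∨ x = blk 1 1 1

/-- membership in the spiral is decidable. [folklore] -/
instance : DecidablePred spiral := fun _ => inferInstanceAs (Decidable (_ ∨ _ ∨ _ ∨ _))

/-- the three unit vectors of the block torus in coordinates. [folklore] -/
theorem unitVec₀ : unitVec M3 0 = blk 1 0 0 := by decide
/-- … [folklore] -/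
theorem unitVec₁ : unitVec M3 1 = blk 0 1 0 := by decide
/-- … [folklore] -/
theorem unitVec₂ : unitVec M3 2 = blk 0 0 1 := by decide

/-- coordinatewise addition ∕ subtraction of blocks. [folklore] -/
theorem blk_add_blk (a₀ a₁ a₂ b₀ b₁ b₂ : ZMod 4) : blk a₀ a₁ a₂ + blk b₀ b₁ b₂ = blk (a₀ + b₀) (a₁ + b₁) (a₂ + b₂) := by
  funext κ; fin_cases κ <;> rfl

/-- … [folklore] -/
theorem blk_sub_blk (a₀ a₁ a₂ b₀ b₁ b₂ : ZMod 4) : blk a₀ a₁ a₂ - blk b₀ b₁ b₂ = blk (a₀ - b₀) (a₁ - b₁) (a₂ - b₂) := by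
  funext κ; fin_cases κ <;> rfl

/-- equality of blocks is decided coordinatewise. [folklore] -/
theorem blk_eq_iff (a₀ a₁ a₂ b₀ b₁ b₂ : ZMod 4) : blk a₀ a₁ a₂ = blk b₀ b₁ b₂ ↔ a₀ = b₀ ∧ a₁ = b₁ ∧ a₂ = b₂ := by
  constructor
  · intro h
    have h0 := congr_fun h 0; have h1 := congr_fun h 1; have h2 := congr_fun h 2
    simp [blk] at h0 h1 h2
    exact ⟨h0, h1, h2⟩
  · rintro ⟨rfl, rfl, rfl⟩; rfl

/-- every block of `{0,1}³` lies in the patch of `(1,1,1)`. [folklore] -/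
theorem inPatch_blk {a₀ a₁ a₂ : ZMod 4} (h₀ : a₀ = 0 ∨ a₀ = 1) (h₁ : a₁ = 0 ∨ a₁ = 1) (h₂ : a₂ = 0 ∨ a₂ = 1) :
    InPatch M3 v₁ (blk a₀ a₁ a₂) := by
  intro ν
  fin_cases ν
  · show (1 : ZMod 4) = a₀ + 1 ∨ (1 : ZMod 4) = a₀
    rcases h₀ with rfl | rfl <;> decide
  · show (1 : ZMod 4) = a₁ + 1 ∨ (1 : ZMod 4) = a₁
    rcases h₁ with rfl | rfl <;> decide
  · show (1 : ZMod 4) = a₂ + 1 ∨ (1 : ZMod 4) = a₂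
    rcases h₂ with rfl | rfl <;> decide

/-- membership in the spiral, decided on coordinates. [folklore] -/
theorem spiral_iff (a₀ a₁ a₂ : ZMod 4) : spiral (blk a₀ a₁ a₂) ↔
    (a₀ = 0 ∧ a₁ = 0 ∧ a₂ = 0) ∨ (a₀ = 1 ∧ a₁ = 0 ∧ a₂ = 0) ∨ (a₀ = 1 ∧ a₁ = 1 ∧ a₂ = 0) ∨ (a₀ = 1 ∧ a₁ = 1 ∧ a₂ = 1) := by
  simp only [spiral, blk_eq_iff]

/-- **the spiral 4-chain is NOT splittable along the middle axis at its central vertex** (conflict path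
`(0,0,0) → (1,0,0) → (1,1,0) → (1,1,1)`: the first block is a top-exposed lower block along axis `1`, the last a bottom-exposed upper one).
[folklore] -/
theorem not_splittableAt_spiral : ¬ SplittableAt M3 spiral v₁ 1 := by
  intro h
  have hcf := conflictFree_of_splittableAt h
  -- the two exposed blocks
  have hP000 : InPatch M3 v₁ (blk 0 0 0) := inPatch_blk (Or.inl rfl) (Or.inl rfl) (Or.inl rfl)
  have hP100 : InPatch M3 v₁ (blk 1 0 0) := inPatch_blk (Or.inr rfl) (Or.inl rfl) (Or.inl rfl)
  have hP110 : InPatch M3 v₁ (blk 1 1 0) := inPatch_blk (Or.inr rfl) (Or.inr rfl) (Or.inl rfl)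
  have hP111 : InPatch M3 v₁ (blk 1 1 1) := inPatch_blk (Or.inr rfl) (Or.inr rfl) (Or.inr rfl)
  have hS000 : spiral (blk 0 0 0) := (spiral_iff _ _ _).mpr (by decide)
  have hS100 : spiral (blk 1 0 0) := (spiral_iff _ _ _).mpr (by decide)
  have hS110 : spiral (blk 1 1 0) := (spiral_iff _ _ _).mpr (by decide)
  have hS111 : spiral (blk 1 1 1) := (spiral_iff _ _ _).mpr (by decide)
  have h1 : TopExposedLower M3 spiral v₁ 1 (blk 0 0 0) := by
    refine ⟨hP000, by decide, hS000, ?_⟩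
    rw [unitVec₁, blk_add_blk, spiral_iff]; decide
  have h2 : BotExposedUpper M3 spiral v₁ 1 (blk 1 1 1) := by
    refine ⟨hP111, by decide, hS111, ?_⟩
    rw [unitVec₁, blk_sub_blk, spiral_iff]; decide
  have hc : PConn M3 spiral v₁ (blk 0 0 0) (blk 1 1 1) := by
    refine Relation.ReflTransGen.head (b := blk 1 0 0) ⟨hP000, hP100, hS000, hS100, 0, Or.inl ?_⟩
      (Relation.ReflTransGen.head (b := blk 1 1 0) ⟨hP100, hP110, hS100, hS110, 1, Or.inl ?_⟩
        (Relation.ReflTransGen.head (b := blk 1 1 1) ⟨hP110, hP111, hS110, hS111, 2, Or.inl ?_⟩ Relation.ReflTransGen.refl))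
    · rw [unitVec₀, blk_add_blk]; decide
    · rw [unitVec₁, blk_add_blk]; decide
    · rw [unitVec₂, blk_add_blk]; decide
  exact hcf _ _ h1 h2 hc

/-- hence the spiral 4-chain is NOT locally splittable — the minimal instance of the residue of «Δ1-LOCAL». [folklore] -/
theorem not_locallySplittable_spiral : ¬ LocallySplittable M3 spiral := fun h => not_splittableAt_spiral (h v₁ 1)

/-! ## §2 The complement of a corner contact -/

/-- all blocks except the two blocks `(0,0,0)` and `(1,1,1)`, which touch at the vertex `(1,1,1)` only. [folklore] -/
def antiCorner (x : Tor M3) : Prop := x ≠ blk 0 0 0 ∧ x ≠ blk 1 1 1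

/-- membership in the complement of the corner contact is decidable. [folklore] -/
instance : DecidablePred antiCorner := fun _ => inferInstanceAs (Decidable (_ ∧ _))

/-- membership, decided on coordinates. [folklore] -/
theorem antiCorner_iff (a₀ a₁ a₂ : ZMod 4) : antiCorner (blk a₀ a₁ a₂) ↔ ¬ (a₀ = 0 ∧ a₁ = 0 ∧ a₂ = 0) ∧ ¬ (a₀ = 1 ∧ a₁ = 1 ∧ a₂ = 1) := by
  simp only [antiCorner, ne_eq, blk_eq_iff]

/-- **THE COMPLEMENT OF A CORNER CONTACT IS NOT SPLITTABLE at the contact vertex** (axis `0`: top-exposed lower `(0,1,1)`, bottom-exposed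
upper `(1,0,0)`, conflict path `(0,1,1) → (0,1,0) → (1,1,0) → (1,0,0)` through blocks of the region). [folklore] -/
theorem not_splittableAt_antiCorner : ¬ SplittableAt M3 antiCorner v₁ 0 := by
  intro h
  have hcf := conflictFree_of_splittableAt h
  have hP011 : InPatch M3 v₁ (blk 0 1 1) := inPatch_blk (Or.inl rfl) (Or.inr rfl) (Or.inr rfl)
  have hP010 : InPatch M3 v₁ (blk 0 1 0) := inPatch_blk (Or.inl rfl) (Or.inr rfl) (Or.inl rfl)
  have hP110 : InPatch M3 v₁ (blk 1 1 0) := inPatch_blk (Or.inr rfl) (Or.inr rfl) (Or.inl rfl)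
  have hP100 : InPatch M3 v₁ (blk 1 0 0) := inPatch_blk (Or.inr rfl) (Or.inl rfl) (Or.inl rfl)
  have hS011 : antiCorner (blk 0 1 1) := (antiCorner_iff _ _ _).mpr (by decide)
  have hS010 : antiCorner (blk 0 1 0) := (antiCorner_iff _ _ _).mpr (by decide)
  have hS110 : antiCorner (blk 1 1 0) := (antiCorner_iff _ _ _).mpr (by decide)
  have hS100 : antiCorner (blk 1 0 0) := (antiCorner_iff _ _ _).mpr (by decide)
  have h1 : TopExposedLower M3 antiCorner v₁ 0 (blk 0 1 1) := by
    refine ⟨hP011, by decide, hS011, ?_⟩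
    rw [unitVec₀, blk_add_blk, antiCorner_iff]; decide
  have h2 : BotExposedUpper M3 antiCorner v₁ 0 (blk 1 0 0) := by
    refine ⟨hP100, by decide, hS100, ?_⟩
    rw [unitVec₀, blk_sub_blk, antiCorner_iff]; decide
  have hc : PConn M3 antiCorner v₁ (blk 0 1 1) (blk 1 0 0) := by
    refine Relation.ReflTransGen.head (b := blk 0 1 0) ⟨hP011, hP010, hS011, hS010, 2, Or.inr ?_⟩
      (Relation.ReflTransGen.head (b := blk 1 1 0) ⟨hP010, hP110, hS010, hS110, 0, Or.inl ?_⟩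
        (Relation.ReflTransGen.head (b := blk 1 0 0) ⟨hP110, hP100, hS110, hS100, 1, Or.inr ?_⟩ Relation.ReflTransGen.refl))
    · rw [unitVec₂, blk_add_blk]; decide
    · rw [unitVec₀, blk_add_blk]; decide
    · rw [unitVec₁, blk_add_blk]; decide
  exact hcf _ _ h1 h2 hc

/-- hence **the complement of two corner-touching blocks is NOT locally splittable**: the «Δ1-LOCAL» ENDs do not cover the complement side
of a vertex-only contact of removed cubes (d = 3). [folklore] -/
theorem not_locallySplittable_antiCorner : ¬ LocallySplittable M3 antiCorner := fun h => not_splittableAt_antiCorner (h v₁ 0)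

end Summit.QuantumFields.BalabanUV.T4Continuum.DirichletSplittableResidue
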